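import Literature.Barriers.Parity.SiegelZeroDichotomyPairHLSieveFourier
import Literature.NumberTheory.Sieve.SmoothMajorantEuler
import HarnessLib

/-!
# Tao–Teräväinen 2022, Lemma 3.4 at `k = 2`: the kernel `K_Y` as a finite Euler product

Topic `Literature/Barriers/Parity`, sub-namespace `TaoTeravainen`; third file of the proof of
Tao–Teräväinen's Lemma 3.4 (arXiv:2109.06291, §3.2) at `k = 2`, after `…SieveExpansion.lean` and
`…SieveFourier.lean` (where `Σ = ∑_Y (-1)^{|Y|} ∫_{ℝ⁴} K_Y W_Y`). Everything here is PROVED.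

The source: "By (2.11) and the fact that `μ` is supported on square-free numbers, the left-hand
side factors as an Euler product `∏_p E_p` where `E_p := F_p((1+it'₁)/log R, …)` and
`F_p(z'₁,z''₁,…,z'_k,z''_k) := ∑_{d'₁,d''₁,…,d''_k ∈ {1,p}} ∏ μ(d'_j)μ(d''_j)
∏_{1≤i<j≤k'} 1_{((d*_i)_(p),(d*_j)_(p))∣h_i-h_j} / ([d*₁,…,d*_{k'}]_(p) ∏ (d'_j)^{z'_j}(d''_j)^{z''_j})`."
[cite: TaoTeravainen2021, §3.2 (proof of Lemma 3.4)]

Here the Euler product is FINITE — over the primes `p < R` (`sievePrimes R`), since every slot of a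
tuple in `sieveTuples R` is composed of those primes; the primes `≥ R` dividing the fixed moduli
`d₀, d₁` contribute only the constant factor `outsideFactor R h₁ h₂ d` (they divide no slot). We use
the tree's finite Euler product over squarefree tuples (`CFZ.sum_squarefreeTuples_eq_prod`,
`CFZ.moebius_mul_cpow_eq_prod` of `SmoothMajorantCRT.lean` / `SmoothMajorantEuler.lean`, the
Conlon–Fox–Zhao (32)→(33) step of the Green–Tao linear forms estimate).

* local bookkeeping: `sideHit X j` (does the pattern `X ⊆ slots` meet side `j`), `localExp`
  (`v_p(d*_j) = max(v_p d_j, sideHit)`, `factorization_tupleModulus`), `localCrt p v_pH a X`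
  (the `p`-part `1_{min ≤ v_pH} p^{-max}` of the density), `shiftDiff = |h₁-h₂|`, `outsideFactor`;
* `crtDensity_eq_prod_primes` — `1_{(M,N)∣H}/[M,N] = ∏_{p ∈ S} 1_{min(v_pM,v_pN) ≤ v_pH} p^{-max(v_pM,v_pN)}`
  over any set of primes `S ⊇ primeFactors(MN)`, and `crtDensity_tupleModulus_eq` — the density of
  the expanded moduli is `outsideFactor · ∏_{p<R} localCrt_p(pattern t p)`;
* `slotExp` (`s_{τ_k}` on `Y`, `0` off `Y`), `localFactor p vH a w = E_p = ∑_X localCrt(X) ∏_{k∈X} (-p^{w_k})`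
  and **`sieveKernel_eq_prod`** — `K_Y(τ) = outsideFactor · ∏_{p<R} E_p`.

(As noted in the review of the previous file, for `Y = ∅` the kernel carries no oscillating factor;
all sixteen `K_Y` are treated uniformly through `slotExp`, the slots off `Y` having `p^0 = 1`.)
-/

noncomputable section

open Finset
open scoped ArithmeticFunction.Moebius

namespace Literature.Barriers.Parity

namespace TaoTeravainen

open Literature.NumberTheory.Sieve (CFZ.squarefreeOf CFZ.mem_squarefreeOf CFZ.pattern
  CFZ.sum_squarefreeTuples_eq_prod CFZ.moebius_mul_cpow_eq_prod)

/-! ### The local exponents and the local density at a prime -/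

/-- Whether the pattern `X` meets side `j` (`1` if some slot of side `j` lies in `X`, else `0`):
the exponent of `p` in `[e_j, e'_j]` for squarefree slots. [cite: TaoTeravainen2021, §3.2 (proof of Lemma 3.4)] -/
def sideHit (X : Finset (Fin 4)) (j : Fin 2) : ℕ :=
  if ∃ k ∈ X, slotSide k = j then 1 else 0

/-- `sideHit ≤ 1`. [folklore] -/
theorem sideHit_le_one (X : Finset (Fin 4)) (j : Fin 2) : sideHit X j ≤ 1 := by
  unfold sideHit
  split_ifs <;> norm_num

/-- The empty pattern meets no side. [folklore] -/
@[simp] theorem sideHit_empty (j : Fin 2) : sideHit ∅ j = 0 := by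
  simp [sideHit]

/-- The local exponent `v_p(d*_j) = max(v_p(d_j), sideHit)`. [cite: TaoTeravainen2021, §3.2 (proof of Lemma 3.4)] -/
def localExp (a : Fin 2 → ℕ) (X : Finset (Fin 4)) (j : Fin 2) : ℕ :=
  max (a j) (sideHit X j)

/-- `localExp a ∅ j = a j`. [folklore] -/
@[simp] theorem localExp_empty (a : Fin 2 → ℕ) (j : Fin 2) : localExp a ∅ j = a j := by
  simp [localExp]

/-- **The local density at `p`**: `1_{min(v_p d*₀, v_p d*₁) ≤ v_p(h₁-h₂)} p^{-max(v_p d*₀, v_p d*₁)}`,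
the `p`-part of `1_{(d*₀,d*₁)∣h₁-h₂}/[d*₀,d*₁]` (the source's `1_{((d*_i)_(p),(d*_j)_(p))∣h_i-h_j}/
[d*₁,…,d*_{k'}]_(p)`). [cite: TaoTeravainen2021, §3.2 (proof of Lemma 3.4, definition of `F_p`)] -/
def localCrt (p vH : ℕ) (a : Fin 2 → ℕ) (X : Finset (Fin 4)) : ℝ :=
  if min (localExp a X 0) (localExp a X 1) ≤ vH then
    ((p : ℝ) ^ max (localExp a X 0) (localExp a X 1))⁻¹ else 0

/-- `localCrt ≥ 0`. [folklore] -/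
theorem localCrt_nonneg (p vH : ℕ) (a : Fin 2 → ℕ) (X : Finset (Fin 4)) : 0 ≤ localCrt p vH a X := by
  unfold localCrt
  split_ifs <;> positivity

/-- The shift difference `|h₁ - h₂|` as a natural number. [folklore] -/
def shiftDiff (h₁ h₂ : ℕ) : ℕ :=
  Int.natAbs ((h₁ : ℤ) - h₂)

/-- `|h₁ - h₂| ≠ 0` for distinct shifts. [folklore] -/
theorem shiftDiff_ne_zero {h₁ h₂ : ℕ} (hne : h₁ ≠ h₂) : shiftDiff h₁ h₂ ≠ 0 := by
  unfold shiftDiff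
  intro h
  rw [Int.natAbs_eq_zero, sub_eq_zero] at h
  exact hne (by exact_mod_cast h)

/-- The factor of the density coming from the primes `≥ R` dividing `d₀ d₁` (they divide no slot):
`A_R(d) = ∏_{p ∣ d₀d₁, p ≥ R} 1_{min(v_p d₀, v_p d₁) ≤ v_p(h₁-h₂)} p^{-max(v_p d₀, v_p d₁)}`.
[cite: TaoTeravainen2021, §3.2 (proof of Lemma 3.4: the primes `p > R`)] -/
def outsideFactor (R : ℝ) (h₁ h₂ : ℕ) (d : Fin 2 → ℕ) : ℝ :=
  ∏ p ∈ (d 0 * d 1).primeFactors \ sievePrimes R,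
    localCrt p ((shiftDiff h₁ h₂).factorization p) (fun j => (d j).factorization p) ∅

/-- `outsideFactor ≥ 0`. [folklore] -/
theorem outsideFactor_nonneg (R : ℝ) (h₁ h₂ : ℕ) (d : Fin 2 → ℕ) : 0 ≤ outsideFactor R h₁ h₂ d :=
  Finset.prod_nonneg fun _ _ => localCrt_nonneg _ _ _ _

/-! ### The valuations of the moduli `d*_j` -/

/-- For squarefree `e` and prime `p`: `v_p(e) = 1_{p ∣ e}`. [folklore] -/
theorem factorization_eq_ite_of_squarefree {e p : ℕ} (he : Squarefree e) (hp : p.Prime) :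
    e.factorization p = if p ∣ e then 1 else 0 := by
  by_cases h : p ∣ e
  · rw [if_pos h]
    have h1 : 1 ≤ e.factorization p := hp.factorization_pos_of_dvd he.ne_zero h
    have h2 : e.factorization p ≤ 1 := he.natFactorization_le_one p
    omega
  · rw [if_neg h]
    exact Nat.factorization_eq_zero_of_not_dvd h

/-- Side `0` is hit by the pattern of `t` at `p` iff `p ∣ t₀` or `p ∣ t₁`. [folklore] -/
theorem sideHit_pattern_zero (t : Fin 4 → ℕ) (p : ℕ) :
    sideHit (CFZ.pattern t p) 0 = if p ∣ t 0 ∨ p ∣ t 1 then 1 else 0 := by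
  have hmem : ∀ k, k ∈ CFZ.pattern t p ↔ p ∣ t k := fun k => by simp [CFZ.pattern]
  have hiff : (∃ k ∈ CFZ.pattern t p, slotSide k = 0) ↔ (p ∣ t 0 ∨ p ∣ t 1) := by
    constructor
    · rintro ⟨k, hk, hks⟩
      rw [hmem] at hk
      fin_cases k
      · exact Or.inl hk
      · exact Or.inr hk
      · simp [slotSide] at hks
      · simp [slotSide] at hks
    · rintro (h | h)
      · exact ⟨0, (hmem 0).mpr h, rfl⟩
      · exact ⟨1, (hmem 1).mpr h, rfl⟩
  unfold sideHit
  by_cases h : p ∣ t 0 ∨ p ∣ t 1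
  · rw [if_pos (hiff.mpr h), if_pos h]
  · rw [if_neg (mt hiff.mp h), if_neg h]

/-- Side `1` is hit by the pattern of `t` at `p` iff `p ∣ t₂` or `p ∣ t₃`. [folklore] -/
theorem sideHit_pattern_one (t : Fin 4 → ℕ) (p : ℕ) :
    sideHit (CFZ.pattern t p) 1 = if p ∣ t 2 ∨ p ∣ t 3 then 1 else 0 := by
  have hmem : ∀ k, k ∈ CFZ.pattern t p ↔ p ∣ t k := fun k => by simp [CFZ.pattern]
  have hiff : (∃ k ∈ CFZ.pattern t p, slotSide k = 1) ↔ (p ∣ t 2 ∨ p ∣ t 3) := by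
    constructor
    · rintro ⟨k, hk, hks⟩
      rw [hmem] at hk
      fin_cases k
      · simp [slotSide] at hks
      · simp [slotSide] at hks
      · exact Or.inl hk
      · exact Or.inr hk
    · rintro (h | h)
      · exact ⟨2, (hmem 2).mpr h, rfl⟩
      · exact ⟨3, (hmem 3).mpr h, rfl⟩
  unfold sideHit
  by_cases h : p ∣ t 2 ∨ p ∣ t 3
  · rw [if_pos (hiff.mpr h), if_pos h]
  · rw [if_neg (mt hiff.mp h), if_neg h]

/-- `max(1_{A}, 1_{B}) = 1_{A ∨ B}` in `ℕ`. [folklore] -/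
theorem max_ite_ite_eq (A B : Prop) [Decidable A] [Decidable B] :
    max (if A then 1 else 0) (if B then 1 else 0) = (if A ∨ B then (1 : ℕ) else 0) := by
  by_cases hA : A <;> by_cases hB : B <;> simp [hA, hB]

/-- The valuation of `d*_j` at a prime `p`, for squarefree slots:
`v_p([d_j, e_j, e'_j]) = max(v_p d_j, sideHit (pattern t p) j)`. [cite: TaoTeravainen2021, §3.2 (proof of Lemma 3.4)] -/
theorem factorization_tupleModulus {d : Fin 2 → ℕ} (hd : ∀ j, d j ≠ 0) {t : Fin 4 → ℕ}
    (ht : ∀ k, Squarefree (t k)) {p : ℕ} (hp : p.Prime) (j : Fin 2) :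
    (tupleModulus d t j).factorization p =
      localExp (fun j => (d j).factorization p) (CFZ.pattern t p) j := by
  have ht0 : ∀ k, t k ≠ 0 := fun k => (ht k).ne_zero
  fin_cases j
  · show (tupleModulus d t 0).factorization p = localExp (fun j => (d j).factorization p) (CFZ.pattern t p) 0
    rw [tupleModulus_zero, Nat.factorization_lcm (hd 0) (Nat.lcm_ne_zero (ht0 0) (ht0 1)),
      Finsupp.sup_apply, Nat.factorization_lcm (ht0 0) (ht0 1), Finsupp.sup_apply,
      factorization_eq_ite_of_squarefree (ht 0) hp, factorization_eq_ite_of_squarefree (ht 1) hp,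
      max_ite_ite_eq, localExp, sideHit_pattern_zero]
  · show (tupleModulus d t 1).factorization p = localExp (fun j => (d j).factorization p) (CFZ.pattern t p) 1
    rw [tupleModulus_one, Nat.factorization_lcm (hd 1) (Nat.lcm_ne_zero (ht0 2) (ht0 3)),
      Finsupp.sup_apply, Nat.factorization_lcm (ht0 2) (ht0 3), Finsupp.sup_apply,
      factorization_eq_ite_of_squarefree (ht 2) hp, factorization_eq_ite_of_squarefree (ht 3) hp,
      max_ite_ite_eq, localExp, sideHit_pattern_one]

/-- `primeFactors [a, b] ⊆ primeFactors a ∪ primeFactors b`. [folklore] -/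
theorem primeFactors_lcm_subset {a b : ℕ} (ha : a ≠ 0) (hb : b ≠ 0) :
    (Nat.lcm a b).primeFactors ⊆ a.primeFactors ∪ b.primeFactors := by
  rw [← Nat.primeFactors_mul ha hb]
  exact Nat.primeFactors_mono (Nat.lcm_dvd_mul a b) (Nat.mul_ne_zero ha hb)

/-- A prime outside `P` divides no slot of a tuple of `P`-numbers, so the pattern is empty. [folklore] -/
theorem pattern_eq_empty_of_not_mem {P : Finset ℕ} (hP : ∀ p ∈ P, p.Prime) {t : Fin 4 → ℕ}
    (ht : ∀ k, t k ∈ CFZ.squarefreeOf P) {p : ℕ} (hp : p.Prime) (hpP : p ∉ P) :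
    CFZ.pattern t p = ∅ := by
  ext k
  simp only [CFZ.pattern, Finset.mem_filter, Finset.mem_univ, true_and, Finset.notMem_empty,
    iff_false]
  intro hpk
  have hsub := ((CFZ.mem_squarefreeOf hP).mp (ht k)).2
  exact hpP (hsub (Nat.mem_primeFactors.mpr ⟨hp, hpk, ((CFZ.mem_squarefreeOf hP).mp (ht k)).1.ne_zero⟩))

/-! ### The density `1_{(d*₀,d*₁)∣h₁-h₂}/[d*₀,d*₁]` as an Euler product -/

/-- **The factorisation of `1_{(M,N)∣H}/[M,N]` over a set of primes containing all prime factors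
of `M N`** (`M, N, H ≥ 1`): `= ∏_{p ∈ S} 1_{min(v_pM,v_pN) ≤ v_pH} p^{-max(v_pM,v_pN)}`. [folklore] -/
theorem crtDensity_eq_prod_primes {h₁ h₂ : ℕ} (hne : h₁ ≠ h₂) {M N : ℕ} (hM : M ≠ 0) (hN : N ≠ 0)
    {S : Finset ℕ} (hMS : M.primeFactors ⊆ S) (hNS : N.primeFactors ⊆ S) :
    crtDensity h₁ h₂ M N =
      ∏ p ∈ S, (if min (M.factorization p) (N.factorization p) ≤ (shiftDiff h₁ h₂).factorization p
        then ((p : ℝ) ^ max (M.factorization p) (N.factorization p))⁻¹ else 0) := by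
  classical
  set H := shiftDiff h₁ h₂ with hH
  have hH0 : H ≠ 0 := shiftDiff_ne_zero hne
  have hg0 : Nat.gcd M N ≠ 0 := Nat.gcd_ne_zero_left hM
  have hl0 : Nat.lcm M N ≠ 0 := Nat.lcm_ne_zero hM hN
  -- the lcm as a product over `S`
  have hlcm : (Nat.lcm M N : ℝ) = ∏ p ∈ S, (p : ℝ) ^ max (M.factorization p) (N.factorization p) := by
    have h1 : Nat.lcm M N = ∏ p ∈ S, p ^ max (M.factorization p) (N.factorization p) := by
      conv_lhs => rw [← Nat.prod_factorization_pow_eq_self hl0]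
      rw [Finsupp.prod_of_support_subset (s := S)]
      · refine Finset.prod_congr rfl fun p _ => ?_
        rw [Nat.factorization_lcm hM hN, Finsupp.sup_apply]
      · intro p hp
        rw [Nat.support_factorization] at hp
        rcases Finset.mem_union.mp (primeFactors_lcm_subset hM hN hp) with h | h
        · exact hMS h
        · exact hNS h
      · intro p _
        exact pow_zero p
    rw [h1]
    push_cast
    rfl
  -- the compatibility condition prime by prime
  have hcond : (((Nat.gcd M N : ℕ) : ℤ) ∣ (h₁ : ℤ) - h₂) ↔
      ∀ p ∈ S, min (M.factorization p) (N.factorization p) ≤ H.factorization p := by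
    rw [Int.natCast_dvd, show ((h₁ : ℤ) - h₂).natAbs = H from rfl,
      ← Nat.factorization_le_iff_dvd hg0 hH0, Nat.factorization_gcd hM hN, Finsupp.le_def]
    constructor
    · intro h p _
      have := h p
      rwa [Finsupp.inf_apply] at this
    · intro h p
      rw [Finsupp.inf_apply]
      by_cases hp : p ∈ S
      · exact h p hp
      · -- outside `S` both valuations vanish
        have hM0 : M.factorization p = 0 := by
          apply Finsupp.notMem_support_iff.mp
          rw [Nat.support_factorization]
          exact fun h' => hp (hMS h')
        rw [hM0]
        simp
  -- assemble
  unfold crtDensity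
  rw [← hH] at *
  by_cases hc : ((Nat.gcd M N : ℕ) : ℤ) ∣ (h₁ : ℤ) - h₂
  · rw [if_pos hc, hlcm, one_div, ← Finset.prod_inv_distrib]
    refine Finset.prod_congr rfl fun p hp => ?_
    rw [if_pos ((hcond.mp hc) p hp)]
  · rw [if_neg hc]
    have : ∃ p ∈ S, ¬ min (M.factorization p) (N.factorization p) ≤ H.factorization p := by
      by_contra h
      push Not at h
      exact hc (hcond.mpr h)
    obtain ⟨p, hp, hnot⟩ := this
    rw [Finset.prod_eq_zero hp (if_neg hnot)]

/-- **The density of the expanded moduli as an Euler product**: for a tuple `t` of squarefree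
numbers composed of primes `< R` and `d₀, d₁ ≥ 1`, `h₁ ≠ h₂`,
`1_{(d*₀,d*₁)∣h₁-h₂}/[d*₀,d*₁] = A_R(d) ∏_{p < R} localCrt_p(pattern t p)`.
[cite: TaoTeravainen2021, §3.2 (proof of Lemma 3.4: "By (2.11) … the left-hand side factors as an Euler product")] -/
theorem crtDensity_tupleModulus_eq {R : ℝ} {h₁ h₂ : ℕ} (hne : h₁ ≠ h₂) {d : Fin 2 → ℕ}
    (hd : ∀ j, d j ≠ 0) {t : Fin 4 → ℕ} (ht : ∀ k, t k ∈ CFZ.squarefreeOf (sievePrimes R)) :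
    crtDensity h₁ h₂ (tupleModulus d t 0) (tupleModulus d t 1) =
      outsideFactor R h₁ h₂ d *
        ∏ p ∈ sievePrimes R, localCrt p ((shiftDiff h₁ h₂).factorization p)
          (fun j => (d j).factorization p) (CFZ.pattern t p) := by
  classical
  have hP : ∀ p ∈ sievePrimes R, p.Prime := fun p hp => prime_of_mem_sievePrimes hp
  have htsq : ∀ k, Squarefree (t k) := fun k => ((CFZ.mem_squarefreeOf hP).mp (ht k)).1
  have ht0 : ∀ k, t k ≠ 0 := fun k => (htsq k).ne_zero
  have htP : ∀ k, (t k).primeFactors ⊆ sievePrimes R := fun k => ((CFZ.mem_squarefreeOf hP).mp (ht k)).2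
  set P := sievePrimes R with hPdef
  set S := P ∪ (d 0 * d 1).primeFactors with hSdef
  have hM : tupleModulus d t 0 ≠ 0 := by
    rw [tupleModulus_zero]; exact Nat.lcm_ne_zero (hd 0) (Nat.lcm_ne_zero (ht0 0) (ht0 1))
  have hN : tupleModulus d t 1 ≠ 0 := by
    rw [tupleModulus_one]; exact Nat.lcm_ne_zero (hd 1) (Nat.lcm_ne_zero (ht0 2) (ht0 3))
  have hd01 : (d 0 * d 1).primeFactors = (d 0).primeFactors ∪ (d 1).primeFactors :=
    Nat.primeFactors_mul (hd 0) (hd 1)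
  have hslotS : ∀ k, (t k).primeFactors ⊆ S := fun k p hp =>
    Finset.mem_union.mpr (Or.inl (htP k hp))
  have hdS : ∀ j, (d j).primeFactors ⊆ S := by
    intro j p hp
    rw [hSdef, Finset.mem_union, hd01, Finset.mem_union]
    fin_cases j
    · exact Or.inr (Or.inl hp)
    · exact Or.inr (Or.inr hp)
  have hMS : (tupleModulus d t 0).primeFactors ⊆ S := by
    rw [tupleModulus_zero]
    intro p hp
    rcases Finset.mem_union.mp (primeFactors_lcm_subset (hd 0) (Nat.lcm_ne_zero (ht0 0) (ht0 1)) hp)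
      with h | h
    · exact hdS 0 h
    · rcases Finset.mem_union.mp (primeFactors_lcm_subset (ht0 0) (ht0 1) h) with h' | h'
      · exact hslotS 0 h'
      · exact hslotS 1 h'
  have hNS : (tupleModulus d t 1).primeFactors ⊆ S := by
    rw [tupleModulus_one]
    intro p hp
    rcases Finset.mem_union.mp (primeFactors_lcm_subset (hd 1) (Nat.lcm_ne_zero (ht0 2) (ht0 3)) hp)
      with h | h
    · exact hdS 1 h
    · rcases Finset.mem_union.mp (primeFactors_lcm_subset (ht0 2) (ht0 3) h) with h' | h'
      · exact hslotS 2 h'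
      · exact hslotS 3 h'
  rw [crtDensity_eq_prod_primes hne hM hN hMS hNS]
  -- split `S = P ⊔ (primeFactors ∖ P)`
  have hSsplit : S = P ∪ ((d 0 * d 1).primeFactors \ P) := by
    rw [hSdef, Finset.union_sdiff_self_eq_union]
  have hdisj : Disjoint P ((d 0 * d 1).primeFactors \ P) := Finset.disjoint_sdiff
  rw [hSsplit, Finset.prod_union hdisj, mul_comm]
  congr 1
  · -- the primes outside `P`: empty patterns
    unfold outsideFactor
    refine Finset.prod_congr rfl fun p hp => ?_
    rw [Finset.mem_sdiff] at hp
    have hpp : p.Prime := Nat.prime_of_mem_primeFactors hp.1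
    have hpat : CFZ.pattern t p = ∅ := pattern_eq_empty_of_not_mem hP ht hpp hp.2
    unfold localCrt
    rw [factorization_tupleModulus hd htsq hpp 0, factorization_tupleModulus hd htsq hpp 1, hpat]
  · refine Finset.prod_congr rfl fun p hp => ?_
    have hpp : p.Prime := hP p hp
    unfold localCrt
    rw [factorization_tupleModulus hd htsq hpp 0, factorization_tupleModulus hd htsq hpp 1]

/-! ### The local Euler factor and the Euler product for `K_Y` -/

/-- The slot exponents: `s_{τ_k}` on `Y`, `0` elsewhere. [cite: TaoTeravainen2021, §3.2 (proof of Lemma 3.4)] -/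
def slotExp (R : ℝ) (Y : Finset (Fin 4)) (τ : Fin 4 → ℝ) (k : Fin 4) : ℂ :=
  if k ∈ Y then sParam R (τ k) else 0

/-- **The local Euler factor `E_p`** of the kernel `K_Y` ("`E_p := F_p((1+it'₁)/log R, …)`",
`F_p(z'₁,z''₁,…) := ∑_{d'₁,…,d''_k ∈ {1,p}} ∏ μ(d'_j)μ(d''_j) ∏ 1_{((d*_i)_(p),(d*_j)_(p))∣h_i-h_j} /
([d*₁,…,d*_{k'}]_(p) ∏ (d'_j)^{z'_j}(d''_j)^{z''_j})`"; here the slots carry `p^{+s}`, the sign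
convention of `one_sub_cutoff_eq_integral`). [cite: TaoTeravainen2021, §3.2 (proof of Lemma 3.4, definition of `E_p`, `F_p`)] -/
def localFactor (p : ℕ) (vH : ℕ) (a : Fin 2 → ℕ) (w : Fin 4 → ℂ) : ℂ :=
  ∑ X : Finset (Fin 4), ((localCrt p vH a X : ℝ) : ℂ) * ∏ k ∈ X, (-((p : ℂ) ^ w k))

/-- The slot powers with the padding exponents: `∏_{k ∈ Y} t_k^{s_k} = ∏_k t_k^{w_k}`. [folklore] -/
theorem slotPower_eq_prod_cpow {R : ℝ} (Y : Finset (Fin 4)) (t : Fin 4 → ℕ) (τ : Fin 4 → ℝ) :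
    slotPower R Y t τ = ∏ k, (t k : ℂ) ^ slotExp R Y τ k := by
  classical
  unfold slotPower slotExp
  rw [← Finset.prod_filter_mul_prod_filter_not Finset.univ (fun k => k ∈ Y)]
  have hY : Finset.univ.filter (fun k : Fin 4 => k ∈ Y) = Y := by ext k; simp
  rw [hY]
  have h2 : ∏ k ∈ Finset.univ.filter (fun k : Fin 4 => ¬ k ∈ Y),
      (t k : ℂ) ^ (if k ∈ Y then sParam R (τ k) else 0) = 1 :=
    Finset.prod_eq_one fun k hk => by
      rw [Finset.mem_filter] at hk
      rw [if_neg hk.2, Complex.cpow_zero]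
  rw [h2, mul_one]
  exact Finset.prod_congr rfl fun k hk => by rw [if_pos hk]

/-- **`K_Y` as a finite Euler product** ("the left-hand side factors as an Euler product
`∏_p E_p`"): for `h₁ ≠ h₂`, `d₀, d₁ ≥ 1`,
`K_Y(τ) = A_R(d) ∏_{p < R} E_p`, `E_p = localFactor p v_p(h₁-h₂) (v_p d₀, v_p d₁) (w_k)`.
[cite: TaoTeravainen2021, §3.2 (proof of Lemma 3.4: "the left-hand side factors as an Euler product")] -/
theorem sieveKernel_eq_prod {R : ℝ} {h₁ h₂ : ℕ} (hne : h₁ ≠ h₂) {d : Fin 2 → ℕ} (hd : ∀ j, d j ≠ 0)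
    (Y : Finset (Fin 4)) (τ : Fin 4 → ℝ) :
    sieveKernel R h₁ h₂ d Y τ =
      ((outsideFactor R h₁ h₂ d : ℝ) : ℂ) *
        ∏ p ∈ sievePrimes R, localFactor p ((shiftDiff h₁ h₂).factorization p)
          (fun j => (d j).factorization p) (slotExp R Y τ) := by
  classical
  set P := sievePrimes R with hPdef
  have hP : ∀ p ∈ P, p.Prime := fun p hp => prime_of_mem_sievePrimes hp
  set vH : ℕ → ℕ := fun p => (shiftDiff h₁ h₂).factorization p with hvH
  set a : ℕ → Fin 2 → ℕ := fun p j => (d j).factorization p with ha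
  set w := slotExp R Y τ with hw
  -- the local weight attached to a prime of `P` and a pattern
  set f : P → Finset (Fin 4) → ℂ := fun p X =>
    ((localCrt p (vH p) (a p) X : ℝ) : ℂ) * ∏ k ∈ X, (-(((p : ℕ) : ℂ) ^ w k)) with hf
  have hrhs : ∏ p ∈ P, localFactor p (vH p) (a p) w = ∏ p : P, ∑ X : Finset (Fin 4), f p X := by
    rw [← Finset.prod_coe_sort P]
    rfl
  rw [hrhs, ← CFZ.sum_squarefreeTuples_eq_prod hP f, Finset.mul_sum]
  unfold sieveKernel sieveTuples
  refine Finset.sum_congr rfl fun t htt => ?_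
  rw [Fintype.mem_piFinset] at htt
  have htsq : ∀ k, Squarefree (t k) := fun k => ((CFZ.mem_squarefreeOf hP).mp (htt k)).1
  have ht0 : ∀ k, t k ≠ 0 := fun k => (htsq k).ne_zero
  have htP : ∀ k, (t k).primeFactors ⊆ P := fun k => ((CFZ.mem_squarefreeOf hP).mp (htt k)).2
  -- the Möbius signs and the slot powers: `∏_k μ(t_k) t_k^{w_k} = ∏_{p ∈ P} ∏_{k ∈ pattern} (-p^{w_k})`
  have hcoef : (((∏ k, (μ (t k) : ℝ)) : ℝ) : ℂ) * slotPower R Y t τ =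
      ∏ p ∈ P, ∏ k ∈ CFZ.pattern t p, (-((p : ℂ) ^ w k)) := by
    rw [slotPower_eq_prod_cpow Y t τ]
    push_cast
    rw [← Finset.prod_mul_distrib]
    have h1 : ∀ k, ((μ (t k) : ℤ) : ℂ) * (t k : ℂ) ^ w k =
        ∏ p ∈ (t k).primeFactors, (-((p : ℂ) ^ w k)) := by
      intro k
      have := CFZ.moebius_mul_cpow_eq_prod (htsq k) (-(w k))
      simp only [neg_neg] at this
      exact this
    rw [show (∏ k, ((μ (t k) : ℤ) : ℂ) * (t k : ℂ) ^ slotExp R Y τ k) =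
        ∏ k, ∏ p ∈ (t k).primeFactors, (-((p : ℂ) ^ w k)) from Fintype.prod_congr _ _ h1]
    refine Finset.prod_comm' ?_
    intro k p
    simp only [Finset.mem_univ, true_and, CFZ.pattern, Finset.mem_filter]
    constructor
    · intro hp
      exact ⟨Nat.dvd_of_mem_primeFactors hp, htP k hp⟩
    · rintro ⟨hpd, hpP⟩
      exact Nat.mem_primeFactors.mpr ⟨hP p hpP, hpd, ht0 k⟩
  -- the density
  rw [crtDensity_tupleModulus_eq hne hd htt]
  calc (((∏ k, (μ (t k) : ℝ)) * (outsideFactor R h₁ h₂ d *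
          ∏ p ∈ sievePrimes R, localCrt p ((shiftDiff h₁ h₂).factorization p)
            (fun j => (d j).factorization p) (CFZ.pattern t p)) : ℝ) : ℂ) * slotPower R Y t τ
      = ((outsideFactor R h₁ h₂ d : ℝ) : ℂ) *
          (((∏ p ∈ P, (localCrt p (vH p) (a p) (CFZ.pattern t p) : ℝ)) : ℂ) *
            ((((∏ k, (μ (t k) : ℝ)) : ℝ) : ℂ) * slotPower R Y t τ)) := by
        push_cast
        ring
    _ = ((outsideFactor R h₁ h₂ d : ℝ) : ℂ) *
          ((∏ p ∈ P, ((localCrt p (vH p) (a p) (CFZ.pattern t p) : ℝ) : ℂ)) *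
            ∏ p ∈ P, ∏ k ∈ CFZ.pattern t p, (-((p : ℂ) ^ w k))) := by
        rw [hcoef]
    _ = ((outsideFactor R h₁ h₂ d : ℝ) : ℂ) * ∏ p : P, f p (CFZ.pattern t p) := by
        rw [← Finset.prod_mul_distrib, ← Finset.prod_coe_sort P]

end TaoTeravainen

end Literature.Barriers.Parity
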